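import Summits.ValiantsHypothesis.ValiantsHypothesis.Theorems.SymPencilPerFourOneRowKernel

/-!
# Route `SymPencil` — the one-row and one-column kernel cells of a symmetric representation of
# `per_4` are EMPTY (`--supports` stmt-ValiantsHypothesis-5674; rung currency for `sdc(per_4)`,
# nothing here bears on `VP ≠ VNP`)

Input: the kernel package of a symmetric affine determinantal representation of `per_4` read at
every base point of the kernel space (`SymPencilPerFourBasePointPackage`): `D` invertible symmetric,
`bL`, `CL` (symmetric), `κ ≠ 0`, the first origin moment, the base-point pencil identity
`κ per_4 (v + s z) = det [[0, s bᵀ], [s b, D + CL v + s CL z]]` (`bL v = 0`), and the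
KERNEL INVARIANCE `CL(v) D⁻¹ (im bL) ⊆ im bL` for `v ∈ ker bL` (at size `25` this is the Lagrangian
invariance `SymPencilLagrangianInvariant.mulVec_mem_range_of_lagrangian`).

**Theorems** (`false_of_row_kernel`, `false_of_col_kernel`).  If moreover `ker bL` is
`4`-dimensional and contained in ONE ROW `l` (resp. one column `c`), contradiction.  We build the
linear embeddings `embV` (the row) and `embX` (the other three rows, through `finSuccAboveEquiv`),
check `ker bL = im embV`, `bL ∘ embX` bijective onto `im bL`,
`per_4 (embV w + s · embX x) = s³ per [w; x]` (row permutation `Fin.cycleRange l`, and a transpose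
for columns), and call `SymPencilPerFourOneRowKernel.false_of_oneRow_embedding`.  These are the
cells `(r, dim V, d) = (12, 4, 0)` of size `25` and — given the invariance — `(12, 4, 1)` of size
`26` in the table of `SymPencilSdcPerFourTwentySixCells`. [folklore]
-/

noncomputable section

-- single-conjunct layout: Sub = Summit, duplicated namespace component intended
set_option linter.dupNamespace false

namespace Summit.ValiantsHypothesis.ValiantsHypothesis.Theorems.SymPencilPerFourOneRowCells

open Matrix Module MvPolynomial
open Literature.Computability.AlgebraicComplexity
open Summit.ValiantsHypothesis.ValiantsHypothesis.Theorems.SymPencilPerFourInnerRankRows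
open Summit.ValiantsHypothesis.ValiantsHypothesis.Theorems.SymPencilPerFourRowForms
open Summit.ValiantsHypothesis.ValiantsHypothesis.Theorems.SymPencilPerFourOneRowKernel

universe u

variable {K : Type u} [Field K]

/-- **A `4 × 4` matrix with row `l` equal to `w` and the other rows `s · x`** has permanent
`s³ per [w; x 0; x 1; x 2]` (row permutation `Fin.cycleRange l`). [folklore] -/
theorem permanent_of_row_data (l : Fin 4) (M : Matrix (Fin 4) (Fin 4) K) (w : Fin 4 → K)
    (x : Fin 3 → Fin 4 → K) (s : K) (hl : ∀ j, M l j = w j)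
    (ha : ∀ a j, M (l.succAbove a) j = s * x a j) :
    M.permanent = s ^ 3 * (Matrix.of ![w, x 0, x 1, x 2]).permanent := by
  have h3 : ∀ a : Fin 3, a = 0 ∨ a = 1 ∨ a = 2 := by decide
  have hM : M = (Matrix.of ![w, s • x 0, s • x 1, s • x 2]).submatrix (l.cycleRange) id := by
    ext i j
    rcases Fin.eq_self_or_eq_succAbove l i with rfl | ⟨a, rfl⟩
    · rw [Matrix.submatrix_apply, Fin.cycleRange_self, id, hl]; rfl
    · rw [Matrix.submatrix_apply, Fin.cycleRange_succAbove, id, ha, Matrix.of_apply,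
        Matrix.cons_val_succ]
      rcases h3 a with rfl | rfl | rfl <;> rfl
  rw [hM, Matrix.permanent_permute_cols, permanent_rows_smul₁, per_smul_row₂, per_smul_row₃]
  ring

/-- The same for a matrix with COLUMN `c` equal to `w` and the other columns `s · x`. [folklore] -/
theorem permanent_of_col_data (c : Fin 4) (M : Matrix (Fin 4) (Fin 4) K) (w : Fin 4 → K)
    (x : Fin 3 → Fin 4 → K) (s : K) (hc : ∀ i, M i c = w i)
    (ha : ∀ a i, M i (c.succAbove a) = s * x a i) :
    M.permanent = s ^ 3 * (Matrix.of ![w, x 0, x 1, x 2]).permanent := by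
  rw [← Matrix.permanent_transpose]
  exact permanent_of_row_data c Mᵀ w x s (fun j => hc j) fun a i => ha a i

variable [CharZero K] {ι' : Type*} [Fintype ι'] [DecidableEq ι']

/-- **The one-ROW kernel cell is empty.**  See the module docstring. [folklore] -/
theorem false_of_row_kernel {D : Matrix ι' ι' K} (hD : IsUnit D.det) (hDs : Dᵀ = D)
    (bL : (Fin 4 × Fin 4 → K) →ₗ[K] (ι' → K))
    (CL : (Fin 4 × Fin 4 → K) →ₗ[K] Matrix ι' ι' K) (hCs : ∀ z, (CL z)ᵀ = CL z)
    {κ : K} (hκ : κ ≠ 0)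
    (hii : ∀ z, bL z ⬝ᵥ (D⁻¹ * CL z * D⁻¹) *ᵥ bL z = 0)
    (hN : ∀ v, bL v = 0 → IsUnit (D + CL v).det ∧ ∀ (z : Fin 4 × Fin 4 → K) (s : K),
      κ * MvPolynomial.eval (v + s • z) (perPoly (Fin 4) K) =
        (Matrix.fromBlocks ((s * 0) • (1 : Matrix Unit Unit K))
          (Matrix.replicateRow Unit (s • bL z)) (Matrix.replicateCol Unit (s • bL z))
          (D + CL v + s • CL z)).det)
    (hinv0 : ∀ v, bL v = 0 → ∀ y ∈ LinearMap.range bL, CL v *ᵥ (D⁻¹ *ᵥ y) ∈ LinearMap.range bL)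
    (l : Fin 4) (hrow : ∀ x, bL x = 0 → ∀ i j, i ≠ l → x (i, j) = 0)
    (hk4 : finrank K (LinearMap.ker bL) = 4) : False := by
  classical
  -- the embeddings of the row `l` and of the other rows
  let embV : (Fin 4 → K) →ₗ[K] (Fin 4 × Fin 4 → K) :=
    { toFun := fun w p => if p.1 = l then w p.2 else 0
      map_add' := fun w w' => by
        funext p; simp only [Pi.add_apply]; split_ifs <;> simp
      map_smul' := fun c w => by
        funext p; simp only [Pi.smul_apply, smul_eq_mul, RingHom.id_apply]; split_ifs <;> simp }
  have hembV : ∀ w p, embV w p = if p.1 = l then w p.2 else 0 := fun _ _ => rfl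
  let σ := finSuccAboveEquiv l
  have hσ : ∀ a (h : l.succAbove a ≠ l), σ.symm ⟨l.succAbove a, h⟩ = a := fun a h => by
    rw [Equiv.symm_apply_eq]; exact Subtype.ext (finSuccAboveEquiv_apply l a ▸ rfl)
  let embX : (Fin 3 → Fin 4 → K) →ₗ[K] (Fin 4 × Fin 4 → K) :=
    { toFun := fun x p => if h : p.1 = l then 0 else x (σ.symm ⟨p.1, h⟩) p.2
      map_add' := fun x x' => by
        funext p; simp only [Pi.add_apply]; split_ifs <;> simp
      map_smul' := fun c x => by
        funext p; simp only [Pi.smul_apply, smul_eq_mul, RingHom.id_apply]; split_ifs <;> simp }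
  have hembXl : ∀ x j, embX x (l, j) = 0 := fun x j => by
    show (if h : ((l, j) : Fin 4 × Fin 4).1 = l then (0 : K) else _) = 0
    rw [dif_pos rfl]
  have hembXa : ∀ x a j, embX x (l.succAbove a, j) = x a j := fun x a j => by
    have hne : l.succAbove a ≠ l := Fin.succAbove_ne l a
    show (if h : ((l.succAbove a, j) : Fin 4 × Fin 4).1 = l then (0 : K) else
      x (σ.symm ⟨(l.succAbove a, j).1, h⟩) (l.succAbove a, j).2) = x a j
    rw [dif_neg hne, hσ a hne]
  have hdecomp : ∀ z : Fin 4 × Fin 4 → K,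
      z = embV (fun j => z (l, j)) + embX (fun a j => z (l.succAbove a, j)) := by
    intro z
    funext ⟨i, j⟩
    rcases Fin.eq_self_or_eq_succAbove l i with rfl | ⟨a, rfl⟩
    · rw [Pi.add_apply, hembXl, hembV, if_pos rfl, add_zero]
    · rw [Pi.add_apply, hembXa, hembV, if_neg (Fin.succAbove_ne _ a), zero_add]
  -- `ker bL = im embV`
  have hker_le : LinearMap.ker bL ≤ LinearMap.range embV := by
    intro x hx
    refine ⟨fun j => x (l, j), ?_⟩
    funext ⟨i, j⟩
    rw [hembV]
    split_ifs with h
    · simp only at h; rw [h]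
    · exact (hrow x (LinearMap.mem_ker.1 hx) i j h).symm
  have hker_eq : LinearMap.ker bL = LinearMap.range embV := by
    refine Submodule.eq_of_le_of_finrank_le hker_le ?_
    rw [hk4]
    exact (LinearMap.finrank_range_le embV).trans (by simp)
  have hEV : ∀ w, bL (embV w) = 0 := fun w =>
    LinearMap.mem_ker.1 (hker_eq ▸ LinearMap.mem_range_self embV w)
  have hEX : Function.Injective (bL ∘ₗ embX) := by
    rw [← LinearMap.ker_eq_bot, Submodule.eq_bot_iff]
    intro x hx
    rw [LinearMap.mem_ker, LinearMap.comp_apply] at hx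
    have hmem : embX x ∈ LinearMap.range embV := hker_eq ▸ LinearMap.mem_ker.2 hx
    obtain ⟨w, hw⟩ := hmem
    funext a j
    have h1 := congr_fun hw (l.succAbove a, j)
    rw [hembXa, hembV, if_neg (Fin.succAbove_ne l a)] at h1
    exact h1.symm
  have hEXr : ∀ z, ∃ x, bL (embX x) = bL z := fun z =>
    ⟨fun a j => z (l.succAbove a, j), by
      conv_rhs => rw [hdecomp z]
      rw [map_add, hEV, zero_add]⟩
  have hinv : ∀ (w : Fin 4 → K) (y : ι' → K), y ∈ LinearMap.range bL →
      CL (embV w) *ᵥ (D⁻¹ *ᵥ y) ∈ LinearMap.range bL := fun w y hy => hinv0 _ (hEV w) y hy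
  have hper : ∀ (w : Fin 4 → K) (x : Fin 3 → Fin 4 → K) (s : K),
      MvPolynomial.eval (embV w + s • embX x) (perPoly (Fin 4) K) =
        s ^ 3 * (Matrix.of ![w, x 0, x 1, x 2]).permanent := by
    intro w x s
    rw [eval_perPoly]
    refine permanent_of_row_data l _ w x s (fun j => ?_) (fun a j => ?_)
    · rw [Matrix.of_apply, Pi.add_apply, Pi.smul_apply, hembV, if_pos rfl, hembXl, smul_zero,
        add_zero]
    · rw [Matrix.of_apply, Pi.add_apply, Pi.smul_apply, hembV, if_neg (Fin.succAbove_ne l a),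
        hembXa, smul_eq_mul, zero_add]
  exact false_of_oneRow_embedding hD hDs bL CL hCs hκ hii hN embV embX hEV hEX hEXr hinv hper

/-- **The one-COLUMN kernel cell is empty.**  See the module docstring. [folklore] -/
theorem false_of_col_kernel {D : Matrix ι' ι' K} (hD : IsUnit D.det) (hDs : Dᵀ = D)
    (bL : (Fin 4 × Fin 4 → K) →ₗ[K] (ι' → K))
    (CL : (Fin 4 × Fin 4 → K) →ₗ[K] Matrix ι' ι' K) (hCs : ∀ z, (CL z)ᵀ = CL z)
    {κ : K} (hκ : κ ≠ 0)
    (hii : ∀ z, bL z ⬝ᵥ (D⁻¹ * CL z * D⁻¹) *ᵥ bL z = 0)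
    (hN : ∀ v, bL v = 0 → IsUnit (D + CL v).det ∧ ∀ (z : Fin 4 × Fin 4 → K) (s : K),
      κ * MvPolynomial.eval (v + s • z) (perPoly (Fin 4) K) =
        (Matrix.fromBlocks ((s * 0) • (1 : Matrix Unit Unit K))
          (Matrix.replicateRow Unit (s • bL z)) (Matrix.replicateCol Unit (s • bL z))
          (D + CL v + s • CL z)).det)
    (hinv0 : ∀ v, bL v = 0 → ∀ y ∈ LinearMap.range bL, CL v *ᵥ (D⁻¹ *ᵥ y) ∈ LinearMap.range bL)
    (c : Fin 4) (hcol : ∀ x, bL x = 0 → ∀ i j, j ≠ c → x (i, j) = 0)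
    (hk4 : finrank K (LinearMap.ker bL) = 4) : False := by
  classical
  let embV : (Fin 4 → K) →ₗ[K] (Fin 4 × Fin 4 → K) :=
    { toFun := fun w p => if p.2 = c then w p.1 else 0
      map_add' := fun w w' => by
        funext p; simp only [Pi.add_apply]; split_ifs <;> simp
      map_smul' := fun c w => by
        funext p; simp only [Pi.smul_apply, smul_eq_mul, RingHom.id_apply]; split_ifs <;> simp }
  have hembV : ∀ w p, embV w p = if p.2 = c then w p.1 else 0 := fun _ _ => rfl
  let σ := finSuccAboveEquiv c
  have hσ : ∀ a (h : c.succAbove a ≠ c), σ.symm ⟨c.succAbove a, h⟩ = a := fun a h => by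
    rw [Equiv.symm_apply_eq]; exact Subtype.ext (finSuccAboveEquiv_apply c a ▸ rfl)
  let embX : (Fin 3 → Fin 4 → K) →ₗ[K] (Fin 4 × Fin 4 → K) :=
    { toFun := fun x p => if h : p.2 = c then 0 else x (σ.symm ⟨p.2, h⟩) p.1
      map_add' := fun x x' => by
        funext p; simp only [Pi.add_apply]; split_ifs <;> simp
      map_smul' := fun c x => by
        funext p; simp only [Pi.smul_apply, smul_eq_mul, RingHom.id_apply]; split_ifs <;> simp }
  have hembXc : ∀ x i, embX x (i, c) = 0 := fun x i => by
    show (if h : ((i, c) : Fin 4 × Fin 4).2 = c then (0 : K) else _) = 0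
    rw [dif_pos rfl]
  have hembXa : ∀ x a i, embX x (i, c.succAbove a) = x a i := fun x a i => by
    have hne : c.succAbove a ≠ c := Fin.succAbove_ne c a
    show (if h : ((i, c.succAbove a) : Fin 4 × Fin 4).2 = c then (0 : K) else
      x (σ.symm ⟨(i, c.succAbove a).2, h⟩) (i, c.succAbove a).1) = x a i
    rw [dif_neg hne, hσ a hne]
  have hdecomp : ∀ z : Fin 4 × Fin 4 → K,
      z = embV (fun i => z (i, c)) + embX (fun a i => z (i, c.succAbove a)) := by
    intro z
    funext ⟨i, j⟩
    rcases Fin.eq_self_or_eq_succAbove c j with rfl | ⟨a, rfl⟩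
    · rw [Pi.add_apply, hembXc, hembV, if_pos rfl, add_zero]
    · rw [Pi.add_apply, hembXa, hembV, if_neg (Fin.succAbove_ne _ a), zero_add]
  have hker_le : LinearMap.ker bL ≤ LinearMap.range embV := by
    intro x hx
    refine ⟨fun i => x (i, c), ?_⟩
    funext ⟨i, j⟩
    rw [hembV]
    split_ifs with h
    · simp only at h; rw [h]
    · exact (hcol x (LinearMap.mem_ker.1 hx) i j h).symm
  have hker_eq : LinearMap.ker bL = LinearMap.range embV := by
    refine Submodule.eq_of_le_of_finrank_le hker_le ?_
    rw [hk4]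
    exact (LinearMap.finrank_range_le embV).trans (by simp)
  have hEV : ∀ w, bL (embV w) = 0 := fun w =>
    LinearMap.mem_ker.1 (hker_eq ▸ LinearMap.mem_range_self embV w)
  have hEX : Function.Injective (bL ∘ₗ embX) := by
    rw [← LinearMap.ker_eq_bot, Submodule.eq_bot_iff]
    intro x hx
    rw [LinearMap.mem_ker, LinearMap.comp_apply] at hx
    have hmem : embX x ∈ LinearMap.range embV := hker_eq ▸ LinearMap.mem_ker.2 hx
    obtain ⟨w, hw⟩ := hmem
    funext a i
    have h1 := congr_fun hw (i, c.succAbove a)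
    rw [hembXa, hembV, if_neg (Fin.succAbove_ne c a)] at h1
    exact h1.symm
  have hEXr : ∀ z, ∃ x, bL (embX x) = bL z := fun z =>
    ⟨fun a i => z (i, c.succAbove a), by
      conv_rhs => rw [hdecomp z]
      rw [map_add, hEV, zero_add]⟩
  have hinv : ∀ (w : Fin 4 → K) (y : ι' → K), y ∈ LinearMap.range bL →
      CL (embV w) *ᵥ (D⁻¹ *ᵥ y) ∈ LinearMap.range bL := fun w y hy => hinv0 _ (hEV w) y hy
  have hper : ∀ (w : Fin 4 → K) (x : Fin 3 → Fin 4 → K) (s : K),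
      MvPolynomial.eval (embV w + s • embX x) (perPoly (Fin 4) K) =
        s ^ 3 * (Matrix.of ![w, x 0, x 1, x 2]).permanent := by
    intro w x s
    rw [eval_perPoly]
    refine permanent_of_col_data c _ w x s (fun i => ?_) (fun a i => ?_)
    · rw [Matrix.of_apply, Pi.add_apply, Pi.smul_apply, hembV, if_pos rfl, hembXc, smul_zero,
        add_zero]
    · rw [Matrix.of_apply, Pi.add_apply, Pi.smul_apply, hembV, if_neg (Fin.succAbove_ne c a),
        hembXa, smul_eq_mul, zero_add]
  exact false_of_oneRow_embedding hD hDs bL CL hCs hκ hii hN embV embX hEV hEX hEXr hinv hper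

end Summit.ValiantsHypothesis.ValiantsHypothesis.Theorems.SymPencilPerFourOneRowCells

end
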